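import Summits.BirchSwinnertonDyer.BirchSwinnertonDyer.Theorems.CyclotomicUntwistStableLineCubeClass
import Summits.BirchSwinnertonDyer.BirchSwinnertonDyer.Theorems.CyclotomicUntwistSplitOfCubeDiscriminant
import Literature.Barriers.BirchSwinnertonDyer.RankNotSumOfLocalInvariantsCubicTwists
import HarnessLib

/-!
# The V10 shape at `3` IS the cube class of `Δ_min`: for every elliptic globally minimal `W/ℚ`,
# `W[3]|G_{ℚ₃}` has EXACTLY ONE stable line ⟺ `Δ_min ∉ (ℚ₃ˣ)³` ⟺ `3 ∤ v₃Δ_min ∨ Δ_min/3^v ≢ ±1 (mod 9)`;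
# SPLIT ⟺ cube class ∧ ¬IRR — the tame-torsion cells of O6 classified

Cell `pub/bsd-wall` (D-0145 line `route-BirchSwinnertonDyer-CyclotomicUntwist`), seat `bsd-line-cycu-p2`
(prover seat 2/3, gen 4); helper toward K1/K2 (stmt-BirchSwinnertonDyer-21580 / 21581) and the O6 lane.
THEOREMS ONLY (no definition, no named fact, no `sorry`); BSD is not proved by this file and no crux is.

* `exists_cube_of_cubeClass` — an integer `n` with `3 ∣ v₃(n)` and `n/3^{v₃ n} ≡ ±1 (mod 9)` is a cube in
  `ℚ₃` (Hensel for `X³ − u` from a root mod `27`, the tree's `CubicTwist.padicThree_isCube_of_dvd`; the six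
  residues `u mod 27 ∈ {1, 8, 10, 17, 19, 26}` lift `1, 2, 4, 5, 7, 8`). With `cube_class_of_intCast_eq_cube`
  the cube class of an integer is DECIDED by `(v₃ n mod 3, unit part mod 9)`.
* **`existsUnique_stableLine_iff_not_cubeClass`** — `∃! ℚ₃`-root of `Ψ₃` ⟺ NOT (`3 ∣ v₃Δ_min ∧ Δ′ ≡ ±1 (mod 9)`)
  (⟸ `existsUnique_stableLine_of_not_cubeClass`; ⟹: a cube `Δ` with no root is IRR, with a root has a second
  one — `exists_second_root_of_Δ_eq_cube`).
* **`shapeSplitThree_iff_cubeClass_and_not_shapeIrrThree`** — SPLIT ⟺ cube class ∧ ¬IRR; on the wild cell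
  **`shapeSplitThree_iff_of_classO6`**: SPLIT ⟺ `v₃Δ_min ∈ {3, 9}` ∧ `Δ′ ≡ ±1 (mod 9)` ∧ ¬IRR — with E89
  (IRR ⟺ rows `(2,4,3)/(4,7,9)`) the two tame-torsion cells `(3, II)`, `(3, IV*)` of `WildThreeTameTorsionCellLaw`
  are classified by invariants (census LAW-Ls3: 0 exceptions on 64 687 curves).
References: J.-P. Serre, Invent. Math. 15 (1972) §5.3 [Serre1972]; J.-P. Serre, *Cours d'arithmétique* II §2.2,
§3.3 [Serre1973].
-/

set_option autoImplicit false
-- single-conjunct summit: `Summit.BirchSwinnertonDyer.BirchSwinnertonDyer.…` repeats the name by design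
set_option linter.dupNamespace false

noncomputable section

open scoped Classical

open Polynomial WeierstrassCurve Literature.NumberTheory.EllipticCurves
  Literature.NumberTheory.EllipticCurves.Rank1Residual
  Summit.BirchSwinnertonDyer.Rank1Residual.Additive Summit.BirchSwinnertonDyer.Rank1Residual.O5
  Literature.Barriers.BirchSwinnertonDyer.CubicTwist

namespace Summit.BirchSwinnertonDyer.BirchSwinnertonDyer.Theorems.PSLocalThreeTorsion

/-! ## §1 The cube class of an integer is its cube-ness in `ℚ₃` -/

section Integers

/-- **Cube class ⟹ cube**: `3 ∣ v₃(n)`, `n/3^{v₃ n} ≡ ±1 (mod 9)` ⟹ `n ∈ (ℚ₃ˣ)³` (a unit `≡ ±1 (mod 9)`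
is `≡ a³ (mod 27)` for some `a ∈ {1,2,4,5,7,8}`, then Hensel). [cite: Serre1973, Ch. II §2.2] -/
theorem exists_cube_of_cubeClass (n : ℤ) (h3 : 3 ∣ padicValInt 3 n)
    (h9 : n / 3 ^ padicValInt 3 n % 9 = 1 ∨ n / 3 ^ padicValInt 3 n % 9 = 8) :
    ∃ d : ℚ_[3], (n : ℚ_[3]) = d ^ 3 := by
  obtain ⟨k, hk⟩ := h3
  set w := padicValInt 3 n with hw
  obtain ⟨u, hu⟩ : (3 : ℤ) ^ w ∣ n := by exact_mod_cast padicValInt_dvd (p := 3) n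
  have h3w : (3 : ℤ) ^ w ≠ 0 := pow_ne_zero _ (by norm_num)
  have hdiv : n / 3 ^ w = u := by rw [hu, Int.mul_ediv_cancel_left _ h3w]
  rw [hdiv] at h9
  -- `u ≡ a³ (mod 27)` for some `3 ∤ a`
  obtain ⟨a, ha, h27⟩ : ∃ a : ℤ, ¬ (3 : ℤ) ∣ a ∧ (27 : ℤ) ∣ a ^ 3 - u := by
    set m : ℤ := u % 27 with hm
    have hm0 : 0 ≤ m := Int.emod_nonneg u (by norm_num)
    have hm27 : m < 27 := Int.emod_lt_of_pos u (by norm_num)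
    have hm9 : m % 9 = u % 9 := by rw [hm, Int.emod_emod_of_dvd u (by norm_num : (9 : ℤ) ∣ 27)]
    have hum : (27 : ℤ) ∣ u - m :=
      ⟨u / 27, by rw [hm, Int.emod_def]; ring⟩
    have key : ∀ a c : ℤ, (27 : ℤ) ∣ a ^ 3 - c → c = m → (27 : ℤ) ∣ a ^ 3 - u := by
      rintro a c hac rfl
      have e : a ^ 3 - u = (a ^ 3 - m) - (u - m) := by ring
      rw [e]; exact dvd_sub hac hum
    rw [← hm9] at h9
    interval_cases m
    all_goals (first
      | exact absurd h9 (by decide)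
      | exact ⟨1, by decide, key 1 _ (by decide) rfl⟩
      | exact ⟨2, by decide, key 2 _ (by decide) rfl⟩
      | exact ⟨4, by decide, key 4 _ (by decide) rfl⟩
      | exact ⟨5, by decide, key 5 _ (by decide) rfl⟩
      | exact ⟨7, by decide, key 7 _ (by decide) rfl⟩
      | exact ⟨8, by decide, key 8 _ (by decide) rfl⟩)
  obtain ⟨ρ, -, hρ⟩ := padicThree_isCube_of_dvd ha h27
  refine ⟨(3 : ℚ_[3]) ^ k * ρ, ?_⟩
  rw [hu, hk]; push_cast; rw [hρ]; ring

end Integers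

/-! ## §2 Curves over `ℚ`: the shape at `3` is the cube class of `Δ_min` -/

section Curves

variable (W : WeierstrassCurve ℚ) [W.IsElliptic] [W.IsGloballyMinimal]

omit [W.IsElliptic] in
/-- The cube class of `Δ_min` gives `Δ ∈ (ℚ₃ˣ)³`. [cite: Serre1973, Ch. II §2.2] -/
theorem exists_cube_eq_Δ_of_cubeClass (h3 : 3 ∣ padicValInt 3 W.minimalDiscriminantInt)
    (h9 : W.minimalDiscriminantInt / 3 ^ padicValInt 3 W.minimalDiscriminantInt % 9 = 1 ∨
      W.minimalDiscriminantInt / 3 ^ padicValInt 3 W.minimalDiscriminantInt % 9 = 8) :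
    ∃ d : ℚ_[3], (W.Δ : ℚ_[3]) = d ^ 3 := by
  obtain ⟨d, hd⟩ := exists_cube_of_cubeClass _ h3 h9
  exact ⟨d, by rw [← cast_minimalDiscriminantInt, Rat.cast_intCast, hd]⟩

/-- **EXACTLY ONE stable line at `3` ⟺ `Δ_min` is NOT in the cube class.** [cite: Serre1972, §5.3] -/
theorem existsUnique_stableLine_iff_not_cubeClass :
    (∃ x₀, IsUniqueStableLineThree W x₀) ↔
      ¬ (3 ∣ padicValInt 3 W.minimalDiscriminantInt ∧
        (W.minimalDiscriminantInt / 3 ^ padicValInt 3 W.minimalDiscriminantInt % 9 = 1 ∨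
          W.minimalDiscriminantInt / 3 ^ padicValInt 3 W.minimalDiscriminantInt % 9 = 8)) := by
  constructor
  · rintro ⟨x₀, hx₀⟩ ⟨h3, h9⟩
    obtain ⟨d, hd⟩ := exists_cube_eq_Δ_of_cubeClass W h3 h9
    have hΔ : (W.baseChange ℚ_[3]).Δ = d ^ 3 := by
      rw [WeierstrassCurve.baseChange, WeierstrassCurve.map_Δ, ← hd]; rfl
    obtain ⟨r', hne, hr'⟩ := exists_second_root_of_Δ_eq_cube (W.baseChange ℚ_[3]) hΔ hx₀.1
    exact hne (hx₀.2 r' hr')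
  · intro h
    refine existsUnique_stableLine_of_not_cubeClass W ?_
    by_cases h3 : 3 ∣ padicValInt 3 W.minimalDiscriminantInt
    · right
      constructor <;> intro h' <;> exact h ⟨h3, by omega⟩
    · exact Or.inl h3

/-- **SPLIT ⟺ cube class ∧ ¬IRR** (every elliptic globally minimal `W/ℚ`). [cite: Serre1972, §5.3] -/
theorem shapeSplitThree_iff_cubeClass_and_not_shapeIrrThree :
    ShapeSplitThree W ↔
      (3 ∣ padicValInt 3 W.minimalDiscriminantInt ∧
        (W.minimalDiscriminantInt / 3 ^ padicValInt 3 W.minimalDiscriminantInt % 9 = 1 ∨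
          W.minimalDiscriminantInt / 3 ^ padicValInt 3 W.minimalDiscriminantInt % 9 = 8)) ∧
      ¬ ShapeIrrThree W := by
  rw [shapeSplitThree_iff_cube_and_not_shapeIrrThree]
  constructor
  · rintro ⟨hcube, hnirr⟩
    refine ⟨?_, hnirr⟩
    have hsplit : ShapeSplitThree W :=
      (shapeSplitThree_iff_cube_and_not_shapeIrrThree W).mpr ⟨hcube, hnirr⟩
    exact three_dvd_and_mod_nine_of_shapeSplitThree W hsplit
  · rintro ⟨⟨h3, h9⟩, hnirr⟩
    exact ⟨exists_cube_eq_Δ_of_cubeClass W h3 h9, hnirr⟩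

/-- **The tame-torsion cells classified**: on the wild cell (`ClassO6 W 3`), SPLIT ⟺ `v₃Δ_min ∈ {3, 9}` ∧
`Δ_min/3^v ≡ ±1 (mod 9)` ∧ ¬IRR. [cite: Serre1972, §5.3] [cite: Kraus1990, Théorème (p = 3)] -/
theorem shapeSplitThree_iff_of_classO6 (hO6 : ClassO6 W 3) :
    ShapeSplitThree W ↔
      (padicValInt 3 W.minimalDiscriminantInt = 3 ∨ padicValInt 3 W.minimalDiscriminantInt = 9) ∧
        (W.minimalDiscriminantInt / 3 ^ padicValInt 3 W.minimalDiscriminantInt % 9 = 1 ∨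
          W.minimalDiscriminantInt / 3 ^ padicValInt 3 W.minimalDiscriminantInt % 9 = 8) ∧
        ¬ ShapeIrrThree W := by
  constructor
  · intro h
    obtain ⟨hv, h9⟩ := shapeSplitThree_cell W hO6 h
    obtain ⟨r, r', -, hr, -⟩ := h
    exact ⟨hv, h9, fun hirr ↦ hirr r hr⟩
  · rintro ⟨hv, h9, hnirr⟩
    refine (shapeSplitThree_iff_cubeClass_and_not_shapeIrrThree W).mpr ⟨⟨?_, h9⟩, hnirr⟩
    rcases hv with hv | hv
    · rw [hv]
    · rw [hv]; decide

end Curves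

end Summit.BirchSwinnertonDyer.BirchSwinnertonDyer.Theorems.PSLocalThreeTorsion

end
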